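import Summits.ABC.StewartYu.PadicG3Values
import HarnessLib

/-!
# Cell abc-stewartyu, crux `Y07Odd` (stmt-ABC-19658), line `gen3-slab-odd`: the SIEGEL STEP of the Gen-3 frame —
# integer coefficients `p(ℓ₀, λ)` on the slab class making all level-0 equations vanish

`Summits/ABC/StewartYu/PadicG3Siegel.lean` — cell `abc-stewartyu` (design HOME/p2/SETUP3-SPEC.md §B; seat p2-g4).
Theorems only; no named fact.  Sequel to `PadicG3Values`.

The class `𝔏` (twist class × `p`-adic slab) is chosen BEFORE Siegel (`G3Setup.exists_slab_box`, one pigeonhole);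
here Siegel's lemma over `ℤ` (`SiegelFinset.exists_int_vec_of_finset`) is run on the unknowns `unk L₀ 𝔏` and the
equations `eqs X M` with the cleared rational cores `Dclear(x) · qTerm` (integers by
`exists_int_Dclear_mul_qTerm`): the output `pv` is supported on `unk L₀ 𝔏`, non-zero, bounded by
`⌈#unk · Amax⌉`, and `coreSum pv (x; m) = 0` for every level-0 equation — Nesterenko's Prop. 3.9 / (3.30) in the
`p`-adic frame (sizes `Amax` are the record's (B2)).

WHAT THIS IS NOT: the size bound `Amax` itself (record) and the count `2·#eqs ≤ #unk` ((B1)); no crux moves.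

References: Yu. V. Nesterenko, LNM 1819 (2003), Prop 3.9, (3.25)–(3.30), (3.48); K. Yu, Compositio 74 (1990) §2.3.
-/

noncomputable section

open Finset
open Literature.NumberTheory.Transcendental

namespace Summit.ABC.StewartYu

namespace G3Setup

variable {p : ℕ} [Fact p.Prime] (S : G3Setup p)

/-- **The Siegel step on the slab class** (Nesterenko Prop 3.9 / Yu 1990 Lemma 2.1, `p`-adic frame): integers
`p(ℓ₀,λ)`, not all zero, supported on `unk L₀ 𝔏`, bounded by `⌈#unk · Amax⌉`, with `coreSum = 0` for every
equation `(x; m₀, m) ∈ eqs X M`. [cite: Nesterenko2003, Prop 3.9 with (3.30)] [cite: Yu1990, §2.3 Lemma 2.1] -/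
theorem siegel_slab (H Slev L₀ X M : ℕ) {s : Fin S.n → ℕ} {𝔏 : Finset (Fin S.n → ℤ)} (h𝔏 : 𝔏 ⊆ S.box s)
    {lam0 : Fin S.n → ℤ} (h0 : lam0 ∈ 𝔏)
    (hcard : 2 * (S.eqs X M).card ≤ (S.unk L₀ 𝔏).card)
    {Amax : ℝ} (hAmax : 1 ≤ Amax)
    (hA : ∀ e ∈ S.eqs X M, ∀ u ∈ S.unk L₀ 𝔏,
      |(((S.Dclear s e.1 : ℕ) : ℚ) * S.qTerm H Slev lam0 u e.1 e.2 : ℚ)| ≤ (Amax : ℝ)) :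
    ∃ pv : ℕ × (Fin S.n → ℤ) → ℤ,
      (∀ u, pv u ≠ 0 → u ∈ S.unk L₀ 𝔏) ∧ (∃ u, pv u ≠ 0) ∧
      (∀ u, |pv u| ≤ ⌈((S.unk L₀ 𝔏).card : ℝ) * Amax⌉) ∧
      ∀ e ∈ S.eqs X M, S.coreSum H Slev lam0 (S.unk L₀ 𝔏) pv e.1 e.2 = 0 := by
  classical
  have hE : (S.eqs X M).Nonempty := by
    refine ⟨((0 : ℤ), ((0 : ℕ), fun _ => (0 : ℕ))), ?_⟩
    unfold eqs
    rw [mem_product, mem_Icc]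
    refine ⟨⟨by omega, by omega⟩, ?_⟩
    rw [S.mem_midx]
    simp
  have hunk : ∀ u ∈ S.unk L₀ 𝔏, u.2 ∈ S.box s := by
    intro u hu
    unfold unk at hu
    exact h𝔏 (mem_product.mp hu).2
  obtain ⟨pv, hsupp, hne, hbd, hrel⟩ := SiegelFinset.exists_int_vec_of_finset (S.unk L₀ 𝔏) (S.eqs X M) hE hcard
    (fun e u => S.qTerm H Slev lam0 u e.1 e.2) (fun e => S.Dclear s e.1)
    (fun e _ => S.Dclear_pos s e.1)
    (fun e _ u hu => S.exists_int_Dclear_mul_qTerm H Slev (h𝔏 h0) (hunk u hu) e.1 e.2)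
    hAmax hA
  exact ⟨pv, hsupp, hne, hbd, fun e he => hrel e he⟩

end G3Setup

end Summit.ABC.StewartYu

end
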